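import Summits.ABC.IUTFork.Repair.RHSigmaMass
import Summits.ABC.IUTFork.Conditional.AbcOfCor312SlackBudget
import Summits.ABC.IUTFork.Cor312ThetaSideClosedK
import HarnessLib

/-!
# R-H ROUND 2, Q1′ (ii) ENDPOINT — «S on a stratum Σ whose DISCARDED `(j²−1)`-mass is within `Tol_K` ⟹ abc with the constant shifted by `K`»,
# for a FREE cell set Σ at every genuine datum (the kernel form of «the minimum Σ that still implies abc»)

PROOF-ONLY file (0 definitions, 0 `Prop` facts) of the abc-iut cell, rung LADDER-ABC:A2.RESCUE.H, R-H ROUND 2 Q1′ (ii) (human question relayed by 21-frontier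
2026-08-26T22:12:42Z «what is the MINIMUM Σ that would still imply abc (with worse constant)?»; director-abc g3 22:18:18Z; rh-lead g2 22:41:51Z; MIN-SLICE.md
v0.5 §(ii) «TO TYPE (rh2-T-1, 'Conditional/AbcOfSigmaMass.lean'): "LicenceOn Σ ∧ B_triv(Σᶜ) ≤ Tol ⟹ ABC" for a GENERAL cell set Σ»). Seat abc-iut-rh2-T-1
(threshold typer). Composed BY NAME from: this seat's `Repair/RHSigmaMass.lean` (`offTrivialMass` = `B_triv(σᶜ)`, `offRemainder_le_offTrivialMass`,
`massThreshold_le_onTrivialMass_iff`), abc-iut-rh2-q2-eq `RH.SigmaStrataEq.GenuineK.cor312UpTo_of_licenceOn` (p470233) — the per-datum «S|σ ⟹ weakened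
Cor. 3.12» at abc-iut-c312-7's sharp print-normalised setting — and the binder pattern of `abc_of_offRemainder_sigmaNu_le_tol` (p471150, there for Σ := Σ₄
only), abc-iut-s2-p6 `negLogTheta_settingPrVolSharp_pilotDataOfK_le_genuine` (p447368 line; the Θ-side identification `hΘ`), abc-iut-w4-d128
`bridgeHyps_settingPrVolSharp_of_ideles`, abc-iut-C-cert-3 `Cor312Prov.exists_realising_{q,theta}Ideles_pilotDataOfK` (the CHOSEN realising ideles of
`Conditional.abc_of_SH_v10K_window`), and abc-iut-rh2-q2-cond `Cor312Slack.ABC_of_cor312Slack_budget` (p470555: budget `K`, `η_prm ↦ η_prm + K`).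

WHAT IS TYPED:
* `cor312UpTo_offTrivialMass_of_licenceOn_chosen` — PER DATUM, GENERAL `σ`: for every genuine Θ-volume datum `T` of any `(P, l)`, every context of the
  sharp setting over `T.K` at `pilotDataOfK T.D T.K` with the chosen realising ideles, and EVERY cell set `σ`:
  `LicenceOn … σ ⟹ T.negAbsLogQ ≤ T.negLogTheta + B_triv(σᶜ)` (no S_H beyond `σ`, no number-level Corollary binder);
* **`abc_of_licenceOn_of_offTrivialMass_le`** — explicit 3 = [LIC] 1 · [THR] 1 · [CONE] 1: for a budget `K ≥ 0` and a FREE stratum `σ(P,l,T)`, IF at every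
  admissible `(P, l)` and genuine datum `T` [LIC] the (xi-f) licence holds at the cells of `σ` for OUR typed hull («S on Σ»), [THR] `B_triv(σᶜ) ≤
  ((l+1)/4)·5·(d*·l + K)` (⟺ `mass(σ) ≥ M − Tol_K` by `massThreshold_le_onTrivialMass_iff`; `K = 0`: `Tol(P,l)` of record, print's constants; `K > 0`:
  `C_K ↦ C_K + 40K` in Cor. 2.2 (ii) (C2), cf. `Conditional/AbcOfSigmaMassDisplay.lean` (R1)), and [CONE] `hreg` VERBATIM, THEN `ABC`.
  With `σ := Σ₄` (the licence cells, where [LIC] is a theorem) and `K = 0` it is q2-eq's p471150; here `σ` is ARBITRARY.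
READING (MIN-SLICE (ii)/(iv), numbers not adjectives): the kernel now says «the minimum Σ that still implies abc (constant shifted by `40K`) is ANY Σ with
`B_triv(Σᶜ) ≤ Tol_K(P,l)` at every admissible datum»; since one off-Σ prime cell `(j,p)` costs `≥ (j²−1)·|qLocal_p|/l⋇` (`Repair/RHSigmaMass`
`cellTrivialCost_div_le_offTrivialMass`) and `Tol/M ≈ 30·d*·l/log(q) < 1.4·10⁻¹⁴·d_mod` inside Cor. 2.2 (ii)'s window, on genuine data this forces Σ ⊇ every cell
of non-negligible cost — Q1′ = Q3 (rh-lead g2 / rh2-q3-num 23:13:02Z). HONEST FRAMING: CONDITIONAL; «`ABC` follows from these hypotheses AS TYPED», nothing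
more; [LIC]/[THR] are assumption labels refutable datum by datum (with `σ = Σ_data` [THR] FAILS below `l₀(datum)`, MIN-SLICE (iii)); nothing asserts that abc
is proved or refuted or that [IUTchIII] Cor. 3.12 holds or fails anywhere; no side taken on any author; typed ≠ proved; instantiated ≠ endorsed.
[cite: Mochizuki2012, IUTchIII Cor. 3.12 p. 173–174, Step (xi-f) p. 184; IUTchI Ex. 3.2 (iv) p. 71] [cite: Mochizuki2012, IUTchIV Thm. 1.10 pp. 22–31;
Prop. 1.6 p. 16; Cor. 2.2–2.3 pp. 41–55] [cite: DupuyHilado2025, §3.4, §3.9] [claim: Mochizuki2012, status: disputed] for every IUT locution. Axioms: standard.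
-/

noncomputable section

open Set Function NumberField IsDedekindDomain

namespace Summit.ABC.IUTFork.Conditional.SigmaMass

open Summit.ABC.IUTFork.Thm311 Summit.ABC.IUTFork.Thm311.Real Summit.ABC.IUTFork.Cor312 Summit.ABC.IUTFork.Cor312.Setting
  Summit.ABC.IUTFork.Cor312Vol Summit.ABC.IUTFork.Cor312Prov Literature.IUT.LogThetaLattice Literature.IUT.LogVolume
  Literature.IUT.HodgeTheaters Literature.IUT.LogVolume.ThetaData
  Literature.NumberTheory.DiophantineGeometry.GenEll Summit.ABC.ABC.Theorems
  Summit.ABC.IUTFork.Repair.RH.SigmaLicence Summit.ABC.IUTFork.Repair.RH.SigmaStrataEq Summit.ABC.IUTFork.Repair.RH.SigmaMass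
  Summit.ABC.IUTFork.Conditional

/-- **PER DATUM, GENERAL σ, CHOSEN IDELES: «S on Σ ⟹ the datum's Cor. 3.12 weakened by `B_triv(σᶜ)`».** For every genuine Θ-volume datum `T` of any `(P, l)`,
every context of abc-iut-c312-7's sharp print-normalised setting over `T.K` at `pilotDataOfK T.D T.K` with the CHOSEN realising ideles of the window
certificates (`Cor312Prov.exists_realising_{q,theta}Ideles_pilotDataOfK`), and EVERY cell set `σ`: the licence on `σ` gives
`T.negAbsLogQ ≤ T.negLogTheta + B_triv(σᶜ)` — q2-eq `GenuineK.cor312UpTo_of_licenceOn` (p470233) with the Θ-side identification abc-iut-s2-p6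
`negLogTheta_settingPrVolSharp_pilotDataOfK_le_genuine` (p447368 line) and §1's `offRemainder_le_offTrivialMass`. No S_H beyond `σ`, no number-level
Corollary; «holds AS TYPED for OUR hull»; no side taken. [cite: Mochizuki2012, IUTchIII Cor. 3.12 p. 173–174; IUTchI Ex. 3.2 (iv) p. 71]
[claim: Mochizuki2012, status: disputed] -/
theorem cor312UpTo_offTrivialMass_of_licenceOn_chosen {P : NFPoint} {l : ℕ} (T : Cor22.ThetaVolumeDatumAt P l) :
    letI := T.instFieldF; letI := T.instNumberFieldF; letI := T.instAlgebraF; letI := T.instFieldK;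
        letI := T.instNumberFieldK; letI := T.instAlgebraK; letI := T.instFieldFbar; letI := T.instAlgebraFbar;
        letI := T.instAlgebraKFbar; letI := T.instIsElliptic;
    ∀ (M : Type) [Field M] [NumberField M]
      (archPk : ∀ (j : (thetaIndex (pilotDataOfK T.D T.K)).Label) (vQ : (thetaIndex (pilotDataOfK T.D T.K)).VQ),
        Set ((logShellsDH (pilotDataOfK T.D T.K) (analyticLogv T.K)).Packet j vQ))
      (archSub : ∀ (j : (thetaIndex (pilotDataOfK T.D T.K)).Label) (v : (thetaIndex (pilotDataOfK T.D T.K)).V),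
        Set ((logShellsDH (pilotDataOfK T.D T.K) (analyticLogv T.K)).Packet j ((thetaIndex (pilotDataOfK T.D T.K)).over v)))
      (Ψ : ℤ → ∀ v : (thetaIndex (pilotDataOfK T.D T.K)).V, v ∈ (thetaIndex (pilotDataOfK T.D T.K)).Vbad →
        Set ((logShellsDH (pilotDataOfK T.D T.K) (analyticLogv T.K)).StarPacket v))
      (act : ℤ → ∀ v : (thetaIndex (pilotDataOfK T.D T.K)).V, v ∈ (thetaIndex (pilotDataOfK T.D T.K)).Vbad →
        (logShellsDH (pilotDataOfK T.D T.K) (analyticLogv T.K)).StarPacket v →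
          Module.End ℚ ((logShellsDH (pilotDataOfK T.D T.K) (analyticLogv T.K)).StarPacket v))
      (Mmod : ℤ → ∀ j : (thetaIndex (pilotDataOfK T.D T.K)).LabelStar,
        Set ((logShellsDH (pilotDataOfK T.D T.K) (analyticLogv T.K)).GlobalPacket j.1))
      (region : ℤ → ∀ j : (thetaIndex (pilotDataOfK T.D T.K)).LabelStar, FinDivisor M →
        ∀ vQ : (thetaIndex (pilotDataOfK T.D T.K)).VQ, Set ((logShellsDH (pilotDataOfK T.D T.K) (analyticLogv T.K)).Packet j.1 vQ))
      (n : ℤ) {HT : Type} {LogLink : HT → HT → Type} {IsFull : ∀ {s t : HT}, LogLink s t → Prop}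
      (lat : LGPGaussianLogThetaLattice LogLink IsFull)
      {Frd : Type} {IsoF : Frd → Frd → Type} {Ob : Frd → Type} {realify : Frd → Frd} {Strip : Type}
      {IsoS : Strip → Strip → Type}
      {Mv : ∀ v : (thetaIndex (pilotDataOfK T.D T.K)).V, v ∈ (thetaIndex (pilotDataOfK T.D T.K)).Vbad → Type}
      [∀ v h, Monoid (Mv v h)]
      (sig : GlobalLGPFrobenioidSignature (thetaIndex (pilotDataOfK T.D T.K)).lstar (thetaIndex (pilotDataOfK T.D T.K)).V
        (· ∈ (thetaIndex (pilotDataOfK T.D T.K)).Vbad) Frd IsoF Ob realify Strip IsoS Mv)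
      (split : SplittingMonoids Mv) {ObΔ : Type}
      {N : ∀ v : (thetaIndex (pilotDataOfK T.D T.K)).V, v ∈ (thetaIndex (pilotDataOfK T.D T.K)).Vbad → Type} [∀ v h, Monoid (N v h)]
      (qData : QPilotData ObΔ N)
      (σ : Set (Fin (thetaIndex (pilotDataOfK T.D T.K)).lstar × (thetaIndex (pilotDataOfK T.D T.K)).VQ)),
      LicenceOn
        (settingPrVolSharp (pilotDataOfK T.D T.K) (logvAnalytic_analyticLogv (F := T.K)) M archPk archSub Ψ act Mmod region n lat
          sig split qData (exists_realising_qIdeles_pilotDataOfK T.D).choose (exists_realising_thetaIdeles_pilotDataOfK T.D).choose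
          (exists_realising_qIdeles_pilotDataOfK T.D).choose_spec.1 (exists_realising_qIdeles_pilotDataOfK T.D).choose_spec.2.1) σ →
      T.negAbsLogQ ≤ T.negLogTheta +
        offTrivialMass
          (settingPrVolSharp (pilotDataOfK T.D T.K) (logvAnalytic_analyticLogv (F := T.K)) M archPk archSub Ψ act Mmod region n lat
            sig split qData (exists_realising_qIdeles_pilotDataOfK T.D).choose (exists_realising_thetaIdeles_pilotDataOfK T.D).choose
            (exists_realising_qIdeles_pilotDataOfK T.D).choose_spec.1 (exists_realising_qIdeles_pilotDataOfK T.D).choose_spec.2.1) σ := by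
  intro M _ _ archPk archSub Ψ act Mmod region n HT LogLink IsFull lat Frd IsoF Ob realify Strip IsoS Mv _ sig split ObΔ N _ qData σ hσ
  letI := T.instFieldF; letI := T.instNumberFieldF; letI := T.instAlgebraF; letI := T.instFieldK
  letI := T.instNumberFieldK; letI := T.instAlgebraK; letI := T.instFieldFbar; letI := T.instAlgebraFbar
  letI := T.instAlgebraKFbar; letI := T.instIsElliptic
  have h := GenuineK.cor312UpTo_of_licenceOn T.D T.K M archPk archSub Ψ act Mmod region n lat sig split qData
    (exists_realising_thetaIdeles_pilotDataOfK T.D).choose (exists_realising_qIdeles_pilotDataOfK T.D).choose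
    T.isVolumeInputOf (exists_realising_qIdeles_pilotDataOfK T.D).choose_spec.1
    (exists_realising_qIdeles_pilotDataOfK T.D).choose_spec.2.1 (exists_realising_thetaIdeles_pilotDataOfK T.D).choose_spec.1
    (exists_realising_thetaIdeles_pilotDataOfK T.D).choose_spec.2.1 (exists_realising_qIdeles_pilotDataOfK T.D).choose_spec.2.2 hσ
    (negLogTheta_settingPrVolSharp_pilotDataOfK_le_genuine T.D M archPk archSub Ψ act Mmod region n lat sig split qData
      (exists_realising_qIdeles_pilotDataOfK T.D).choose (exists_realising_thetaIdeles_pilotDataOfK T.D).choose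
      (exists_realising_qIdeles_pilotDataOfK T.D).choose_spec.1 (exists_realising_qIdeles_pilotDataOfK T.D).choose_spec.2.1
      (exists_realising_thetaIdeles_pilotDataOfK T.D).choose_spec.1 (exists_realising_thetaIdeles_pilotDataOfK T.D).choose_spec.2.2
      T.isVolumeInputOf)
  have H := bridgeHyps_settingPrVolSharp_of_ideles (pilotDataOfK T.D T.K) (logvAnalytic_analyticLogv (F := T.K)) M archPk archSub Ψ act
    Mmod region n lat sig split qData (exists_realising_thetaIdeles_pilotDataOfK T.D).choose (exists_realising_qIdeles_pilotDataOfK T.D).choose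
    (exists_realising_thetaIdeles_pilotDataOfK T.D).choose_spec.1 (exists_realising_thetaIdeles_pilotDataOfK T.D).choose_spec.2.1
    (exists_realising_qIdeles_pilotDataOfK T.D).choose_spec.1 (exists_realising_qIdeles_pilotDataOfK T.D).choose_spec.2.1
  exact h.trans (add_le_add le_rfl (offRemainder_le_offTrivialMass H σ))

/-- **`abc_of_licenceOn_of_offTrivialMass_le` — R-H ROUND 2 Q1′ (ii) ENDPOINT: «S on a stratum Σ of licence-mass ≥ M − Tol_K ⟹ abc with the constant
shifted by K».** Explicit 3 = [LIC] 1 · [THR] 1 · [CONE] 1: for context functions as in the certificate of record `Conditional.abc_of_SH_v10K_window`,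
a budget `K ≥ 0`, and a FREE cell set `σ(P,l,T)` at every genuine datum, IF at every admissible `(P, l)` and every genuine Θ-volume datum `T`
[LIC] the (xi-f) licence holds at the cells of `σ` for OUR typed hull at the chosen realising ideles (`LicenceOn … σ` — «S on Σ»), [THR] the
trivially-discarded off-Σ mass is within the budgeted tolerance `B_triv(σᶜ) ≤ ((l+1)/4)·5·(d*·l + K)` (equivalently, by `massThreshold_le_onTrivialMass_iff`,
the retained mass `mass(σ) ≥ M − Tol_K`), and [CONE] the cone binder `hreg` holds VERBATIM, THEN `ABC` — through abc-iut-rh2-q2-cond's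
`Cor312Slack.ABC_of_cor312Slack_budget` (print's display at `η_prm + K`, `C_K ↦ C_K + 40K`, `H_unif = 2^140` unchanged). With `σ := Σ₄` (q2-eq's licence
cells, where [LIC] is a THEOREM) and `K = 0` this is p471150 `abc_of_offRemainder_sigmaNu_le_tol`; here `σ` is arbitrary — the kernel form of MIN-SLICE (ii)
«the minimum Σ that still implies abc is ANY Σ whose discarded `(j²−1)`-mass is `≤ Tol_K`; its constant is print's shifted by `40K`». CONDITIONAL; «`ABC`
follows from these hypotheses AS TYPED», nothing more; [LIC]/[THR] are assumption labels refutable datum by datum (on the genuine bed [THR] with `σ = Σ_data`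
FAILS below `l₀(datum)`, MIN-SLICE (iii)/(iv)); no side taken on [IUTchIII] Cor. 3.12. [cite: Mochizuki2012, IUTchIV Thm. 1.10 pp. 22–31; Prop. 1.6 p. 16;
Cor. 2.2–2.3 pp. 41–55] [cite: Mochizuki2012, IUTchIII Cor. 3.12 p. 174] [claim: Mochizuki2012, status: disputed] -/
theorem abc_of_licenceOn_of_offTrivialMass_le {K : ℝ} (hK : 0 ≤ K)
    (M : ∀ (P : NFPoint) (l : ℕ) (T : Cor22.ThetaVolumeDatumAt P l), Type) [∀ P l T, Field (M P l T)] [∀ P l T, NumberField (M P l T)]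
    (archPk : ∀ (P : NFPoint) (l : ℕ) (T : Cor22.ThetaVolumeDatumAt P l), letI := T.instFieldF; letI := T.instNumberFieldF; letI := T.instAlgebraF; letI := T.instFieldK;
        letI := T.instNumberFieldK; letI := T.instAlgebraK; letI := T.instFieldFbar; letI := T.instAlgebraFbar;
        letI := T.instAlgebraKFbar; letI := T.instIsElliptic;
      ∀ (j : (thetaIndex (pilotDataOfK T.D T.K)).Label) (vQ : (thetaIndex (pilotDataOfK T.D T.K)).VQ), Set ((logShellsDH (pilotDataOfK T.D T.K) (analyticLogv T.K)).Packet j vQ))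
    (archSub : ∀ (P : NFPoint) (l : ℕ) (T : Cor22.ThetaVolumeDatumAt P l), letI := T.instFieldF; letI := T.instNumberFieldF; letI := T.instAlgebraF; letI := T.instFieldK;
        letI := T.instNumberFieldK; letI := T.instAlgebraK; letI := T.instFieldFbar; letI := T.instAlgebraFbar;
        letI := T.instAlgebraKFbar; letI := T.instIsElliptic;
      ∀ (j : (thetaIndex (pilotDataOfK T.D T.K)).Label) (v : (thetaIndex (pilotDataOfK T.D T.K)).V), Set ((logShellsDH (pilotDataOfK T.D T.K) (analyticLogv T.K)).Packet j ((thetaIndex (pilotDataOfK T.D T.K)).over v)))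
    (Ψ : ∀ (P : NFPoint) (l : ℕ) (T : Cor22.ThetaVolumeDatumAt P l), letI := T.instFieldF; letI := T.instNumberFieldF; letI := T.instAlgebraF; letI := T.instFieldK;
        letI := T.instNumberFieldK; letI := T.instAlgebraK; letI := T.instFieldFbar; letI := T.instAlgebraFbar;
        letI := T.instAlgebraKFbar; letI := T.instIsElliptic;
      ℤ → ∀ v : (thetaIndex (pilotDataOfK T.D T.K)).V, v ∈ (thetaIndex (pilotDataOfK T.D T.K)).Vbad → Set ((logShellsDH (pilotDataOfK T.D T.K) (analyticLogv T.K)).StarPacket v))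
    (act : ∀ (P : NFPoint) (l : ℕ) (T : Cor22.ThetaVolumeDatumAt P l), letI := T.instFieldF; letI := T.instNumberFieldF; letI := T.instAlgebraF; letI := T.instFieldK;
        letI := T.instNumberFieldK; letI := T.instAlgebraK; letI := T.instFieldFbar; letI := T.instAlgebraFbar;
        letI := T.instAlgebraKFbar; letI := T.instIsElliptic;
      ℤ → ∀ v : (thetaIndex (pilotDataOfK T.D T.K)).V, v ∈ (thetaIndex (pilotDataOfK T.D T.K)).Vbad → (logShellsDH (pilotDataOfK T.D T.K) (analyticLogv T.K)).StarPacket v → Module.End ℚ ((logShellsDH (pilotDataOfK T.D T.K) (analyticLogv T.K)).StarPacket v))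
    (Mmod : ∀ (P : NFPoint) (l : ℕ) (T : Cor22.ThetaVolumeDatumAt P l), letI := T.instFieldF; letI := T.instNumberFieldF; letI := T.instAlgebraF; letI := T.instFieldK;
        letI := T.instNumberFieldK; letI := T.instAlgebraK; letI := T.instFieldFbar; letI := T.instAlgebraFbar;
        letI := T.instAlgebraKFbar; letI := T.instIsElliptic;
      ℤ → ∀ j : (thetaIndex (pilotDataOfK T.D T.K)).LabelStar, Set ((logShellsDH (pilotDataOfK T.D T.K) (analyticLogv T.K)).GlobalPacket j.1))
    (region : ∀ (P : NFPoint) (l : ℕ) (T : Cor22.ThetaVolumeDatumAt P l), letI := T.instFieldF; letI := T.instNumberFieldF; letI := T.instAlgebraF; letI := T.instFieldK;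
        letI := T.instNumberFieldK; letI := T.instAlgebraK; letI := T.instFieldFbar; letI := T.instAlgebraFbar;
        letI := T.instAlgebraKFbar; letI := T.instIsElliptic;
      ℤ → ∀ j : (thetaIndex (pilotDataOfK T.D T.K)).LabelStar, FinDivisor (M P l T) → ∀ vQ : (thetaIndex (pilotDataOfK T.D T.K)).VQ, Set ((logShellsDH (pilotDataOfK T.D T.K) (analyticLogv T.K)).Packet j.1 vQ))
    (n : ∀ (P : NFPoint) (l : ℕ) (T : Cor22.ThetaVolumeDatumAt P l), ℤ)
    {HT : ∀ (P : NFPoint) (l : ℕ) (T : Cor22.ThetaVolumeDatumAt P l), Type} {LogLink : ∀ (P : NFPoint) (l : ℕ) (T : Cor22.ThetaVolumeDatumAt P l), HT P l T → HT P l T → Type}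
    {IsFull : ∀ (P : NFPoint) (l : ℕ) (T : Cor22.ThetaVolumeDatumAt P l), ∀ {s t : HT P l T}, LogLink P l T s t → Prop}
    (lat : ∀ (P : NFPoint) (l : ℕ) (T : Cor22.ThetaVolumeDatumAt P l), LGPGaussianLogThetaLattice (LogLink P l T) (IsFull P l T))
    {Frd : ∀ (P : NFPoint) (l : ℕ) (T : Cor22.ThetaVolumeDatumAt P l), Type} {IsoF : ∀ (P : NFPoint) (l : ℕ) (T : Cor22.ThetaVolumeDatumAt P l), Frd P l T → Frd P l T → Type} {Ob : ∀ (P : NFPoint) (l : ℕ) (T : Cor22.ThetaVolumeDatumAt P l), Frd P l T → Type}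
    {realify : ∀ (P : NFPoint) (l : ℕ) (T : Cor22.ThetaVolumeDatumAt P l), Frd P l T → Frd P l T} {Strip : ∀ (P : NFPoint) (l : ℕ) (T : Cor22.ThetaVolumeDatumAt P l), Type} {IsoS : ∀ (P : NFPoint) (l : ℕ) (T : Cor22.ThetaVolumeDatumAt P l), Strip P l T → Strip P l T → Type}
    {Mv : ∀ (P : NFPoint) (l : ℕ) (T : Cor22.ThetaVolumeDatumAt P l), letI := T.instFieldF; letI := T.instNumberFieldF; letI := T.instAlgebraF; letI := T.instFieldK;
        letI := T.instNumberFieldK; letI := T.instAlgebraK; letI := T.instFieldFbar; letI := T.instAlgebraFbar;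
        letI := T.instAlgebraKFbar; letI := T.instIsElliptic;
      ∀ v : (thetaIndex (pilotDataOfK T.D T.K)).V, v ∈ (thetaIndex (pilotDataOfK T.D T.K)).Vbad → Type}
    [∀ P l T v h, Monoid (Mv P l T v h)]
    (sig : ∀ (P : NFPoint) (l : ℕ) (T : Cor22.ThetaVolumeDatumAt P l), letI := T.instFieldF; letI := T.instNumberFieldF; letI := T.instAlgebraF; letI := T.instFieldK;
        letI := T.instNumberFieldK; letI := T.instAlgebraK; letI := T.instFieldFbar; letI := T.instAlgebraFbar;
        letI := T.instAlgebraKFbar; letI := T.instIsElliptic;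
      GlobalLGPFrobenioidSignature (thetaIndex (pilotDataOfK T.D T.K)).lstar (thetaIndex (pilotDataOfK T.D T.K)).V (· ∈ (thetaIndex (pilotDataOfK T.D T.K)).Vbad) (Frd P l T) (IsoF P l T) (Ob P l T) (realify P l T)
        (Strip P l T) (IsoS P l T) (Mv P l T))
    (split : ∀ (P : NFPoint) (l : ℕ) (T : Cor22.ThetaVolumeDatumAt P l), SplittingMonoids (Mv P l T))
    {ObΔ : ∀ (P : NFPoint) (l : ℕ) (T : Cor22.ThetaVolumeDatumAt P l), Type} {N : ∀ (P : NFPoint) (l : ℕ) (T : Cor22.ThetaVolumeDatumAt P l), letI := T.instFieldF; letI := T.instNumberFieldF; letI := T.instAlgebraF; letI := T.instFieldK;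
        letI := T.instNumberFieldK; letI := T.instAlgebraK; letI := T.instFieldFbar; letI := T.instAlgebraFbar;
        letI := T.instAlgebraKFbar; letI := T.instIsElliptic;
      ∀ v : (thetaIndex (pilotDataOfK T.D T.K)).V, v ∈ (thetaIndex (pilotDataOfK T.D T.K)).Vbad → Type}
    [∀ P l T v h, Monoid (N P l T v h)] (qData : ∀ (P : NFPoint) (l : ℕ) (T : Cor22.ThetaVolumeDatumAt P l), QPilotData (ObΔ P l T) (N P l T))
    -- the FREE stratum: a cell set at every genuine datum
    (σ : ∀ (P : NFPoint) (l : ℕ) (T : Cor22.ThetaVolumeDatumAt P l), letI := T.instFieldF; letI := T.instNumberFieldF; letI := T.instAlgebraF; letI := T.instFieldK;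
        letI := T.instNumberFieldK; letI := T.instAlgebraK; letI := T.instFieldFbar; letI := T.instAlgebraFbar;
        letI := T.instAlgebraKFbar; letI := T.instIsElliptic;
      Set (Fin (thetaIndex (pilotDataOfK T.D T.K)).lstar × (thetaIndex (pilotDataOfK T.D T.K)).VQ))
    -- [LIC] «S on Σ»: the (xi-f) licence at the cells of `σ`, for OUR typed hull at the chosen realising ideles, at every admissible datum
    (hLic : ∀ P : NFPoint, P ∈ UP → ∀ l : ℕ, l.Prime → 5 ≤ l →
      Cor22.AdmitsCore P → Cor22.CondP2 P l → Cor22.CondP5 P l → Cor22.CondP6 P l →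
      ∀ T : Cor22.ThetaVolumeDatumAt P l, letI := T.instFieldF; letI := T.instNumberFieldF; letI := T.instAlgebraF; letI := T.instFieldK;
        letI := T.instNumberFieldK; letI := T.instAlgebraK; letI := T.instFieldFbar; letI := T.instAlgebraFbar;
        letI := T.instAlgebraKFbar; letI := T.instIsElliptic;
      LicenceOn
        (settingPrVolSharp (pilotDataOfK T.D T.K) (logvAnalytic_analyticLogv (F := T.K)) (M P l T) (archPk P l T) (archSub P l T) (Ψ P l T)
          (act P l T) (Mmod P l T) (region P l T) (n P l T) (lat P l T) (sig P l T) (split P l T) (qData P l T)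
          (exists_realising_qIdeles_pilotDataOfK T.D).choose
          (exists_realising_thetaIdeles_pilotDataOfK T.D).choose
          (exists_realising_qIdeles_pilotDataOfK T.D).choose_spec.1
          (exists_realising_qIdeles_pilotDataOfK T.D).choose_spec.2.1) (σ P l T))
    -- [THR] the off-Σ trivial mass is within the budgeted tolerance `Tol_K(P,l) = ((l+1)/4)·5·(d*·l + K)` (⟺ mass(σ) ≥ M − Tol_K), at every admissible datum
    (hThr : ∀ P : NFPoint, P ∈ UP → ∀ l : ℕ, l.Prime → 5 ≤ l →
      Cor22.AdmitsCore P → Cor22.CondP2 P l → Cor22.CondP5 P l → Cor22.CondP6 P l →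
      ∀ T : Cor22.ThetaVolumeDatumAt P l, letI := T.instFieldF; letI := T.instNumberFieldF; letI := T.instAlgebraF; letI := T.instFieldK;
        letI := T.instNumberFieldK; letI := T.instAlgebraK; letI := T.instFieldFbar; letI := T.instAlgebraFbar;
        letI := T.instAlgebraKFbar; letI := T.instIsElliptic;
      offTrivialMass
        (settingPrVolSharp (pilotDataOfK T.D T.K) (logvAnalytic_analyticLogv (F := T.K)) (M P l T) (archPk P l T) (archSub P l T) (Ψ P l T)
          (act P l T) (Mmod P l T) (region P l T) (n P l T) (lat P l T) (sig P l T) (split P l T) (qData P l T)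
          (exists_realising_qIdeles_pilotDataOfK T.D).choose
          (exists_realising_thetaIdeles_pilotDataOfK T.D).choose
          (exists_realising_qIdeles_pilotDataOfK T.D).choose_spec.1
          (exists_realising_qIdeles_pilotDataOfK T.D).choose_spec.2.1) (σ P l T) ≤
        ((l : ℝ) + 1) / 4 * (5 * ((((2 ^ 12 * 3 ^ 3 * 5 * Cor22.dmod P : ℕ) : ℝ)) * l + K)))
    -- [CONE] the cone binder of the chain of record, VERBATIM
    (hreg : ∀ P : NFPoint, P ∈ UP → ∀ l : ℕ, l.Prime → 5 ≤ l →
      Cor22.AdmitsCore P → Cor22.CondP2 P l → Cor22.CondP5 P l → Cor22.CondP6 P l →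
      ∀ T : Cor22.ThetaVolumeDatumAt P l,
        (letI := T.instFieldF; letI := T.instNumberFieldF; letI := T.instAlgebraF; letI := T.instFieldK
         letI := T.instNumberFieldK; letI := T.instAlgebraK; letI := T.instFieldFbar; letI := T.instAlgebraFbar
         letI := T.instAlgebraKFbar; letI := T.instIsElliptic
         ¬ (∀ p ∈ T.I.supportPrimes, ∀ v w : placesOver (fieldOfModuli T.E) p,
            (Summit.ABC.IUTFork.DHData.ofInput T.I).logQloc p v = (Summit.ABC.IUTFork.DHData.ofInput T.I).logQloc p w)) →
        T.HullEstimateOf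
          (((l : ℝ) + 1) / 4 *
            ((1 + 12 * (Cor22.dmod P : ℝ) / l) * (P.logDiff + Cor22.logCondAvoid P {2, l})
              + 2 * Real.log l + 52
              + 20 / 3 * Real.log (((2 ^ 12 * 3 ^ 3 * 5 * Cor22.dmod P : ℕ) : ℝ) * (l : ℝ))
                * (Nat.primeCounting (2 ^ 12 * 3 ^ 3 * 5 * Cor22.dmod P * l) : ℝ)))) :
    _root_.ABC :=
  Cor312Slack.ABC_of_cor312Slack_budget hK
    (fun P l T => letI := T.instFieldF; letI := T.instNumberFieldF; letI := T.instAlgebraF; letI := T.instFieldK;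
        letI := T.instNumberFieldK; letI := T.instAlgebraK; letI := T.instFieldFbar; letI := T.instAlgebraFbar;
        letI := T.instAlgebraKFbar; letI := T.instIsElliptic;
      offTrivialMass
        (settingPrVolSharp (pilotDataOfK T.D T.K) (logvAnalytic_analyticLogv (F := T.K)) (M P l T) (archPk P l T) (archSub P l T) (Ψ P l T)
          (act P l T) (Mmod P l T) (region P l T) (n P l T) (lat P l T) (sig P l T) (split P l T) (qData P l T)
          (exists_realising_qIdeles_pilotDataOfK T.D).choose
          (exists_realising_thetaIdeles_pilotDataOfK T.D).choose
          (exists_realising_qIdeles_pilotDataOfK T.D).choose_spec.1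
          (exists_realising_qIdeles_pilotDataOfK T.D).choose_spec.2.1) (σ P l T))
    (fun P hP l hl h5 hc h2 h5' h6 T => cor312UpTo_offTrivialMass_of_licenceOn_chosen T (M P l T) (archPk P l T) (archSub P l T) (Ψ P l T)
      (act P l T) (Mmod P l T) (region P l T) (n P l T) (lat P l T) (sig P l T) (split P l T) (qData P l T) (σ P l T)
      (hLic P hP l hl h5 hc h2 h5' h6 T))
    hThr hreg

end Summit.ABC.IUTFork.Conditional.SigmaMass

end
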